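import Mathlib
import Summits.ResolutionOfSingularities.ResolutionOfSingularities.Theorems.WeightedInvariantLocalWeightedDropTOT2CurveConflictShift
import Summits.ResolutionOfSingularities.ResolutionOfSingularities.Theorems.WeightedInvariantLocalWeightedDropNCPolyBridgePointMove

/-!
# `LocalWeightedDrop`, NC count game — TOT2-LINE piece S-CRV (v1.1 (D)): THE CONFLICT STEP in the count game — the point move of a represented
# position carrying a graph branch, with boundary bookkeeping AND the branch's new datum (glue of `NCPoly.pointMove_of_represents` with F1/F3)

[OURS · L1 W4.3 · chain w43, engine crux `LocalWeightedDrop` stmt-ResolutionOfSingularities-8899; piece S-CRV = res-type-088; `--supports 8899 --as helper`,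
counted 0; definition-free; nothing here is a statement of any manuscript; AI-written (gate-accepted = sorry-free with standard axioms, not refereed).]

At a CONFLICT state of the TOT2-LINE (`NCPoly.Conflict`: a graph-curve step of Σ**_d with `u₂` a boundary letter) the E-aware strategy blows up the
POINT.  For the consumer of lead-1's `dWinsTo_exit` (inner composition (G3)) this file packages that move:
* `exists_eq_C_add_X_mul_of_noY` — a `u₂`-free datum splits as `h = λ + u₁h₁` with `λ = h(0)` and `h₁` `u₂`-free;
* **`conflict_pointMove`** — from a position `b` representing a positive label `A` with boundary `N` that carries a permissible graph branch with
  datum `λ + u₁h₁`: the point blow-up (all weights 1, the representing coordinates) is a legal count move and EVERY successor position is unit ×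
  monomial, or represents `blowOneT d (shearT (C c) A)` with boundary `{u₁} ∪ {u₂ : u₂ ∈ N, c = 0}` for some `c : k` — where AT `c = λ` (the point
  of the branch) the new label again carries a permissible graph branch, with datum `h₁` (F3 `graph_blowOneT_translate`; contact with `V(u₂)` ONE
  LESS when `λ = 0`, and `u₂` no longer a boundary letter when `λ ≠ 0`) —, or represents `blowTwoT d A` with boundary `{u₂} ∪ {u₁ : u₁ ∈ N}`;
* `conflict_pointMove'` — the same from `HasGraphCurveT`-style data `(h, ψ)` with the conclusion `HasGraphCurveT` at `c = h(0)`.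
-/

set_option linter.dupNamespace false -- mandated namespace of this single-conjunct summit

noncomputable section

namespace Summit.ResolutionOfSingularities.ResolutionOfSingularities.Theorems

namespace TOT2Curve

open MvPowerSeries PolyDescent MonicDescent WildMonic Literature.AlgebraicGeometry.Resolution TameFourTupleDrop

variable {k : Type} [Field k] {d : ℕ}

/-- A `u₂`-free series splits as `h = h(0) + u₁·h₁` with `h₁` `u₂`-free. -/
theorem exists_eq_C_add_X_mul_of_noY (h : MvPowerSeries (Fin 2) k) (hh : ∀ e : Fin 2 →₀ ℕ, e 1 ≠ 0 → coeff e h = 0) :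
    ∃ h₁ : MvPowerSeries (Fin 2) k, (∀ e : Fin 2 →₀ ℕ, e 1 ≠ 0 → coeff e h₁ = 0) ∧ h = C (constantCoeff h) + X 0 * h₁ := by
  refine ⟨divOne 1 (h - C (constantCoeff h)), fun e he => ?_, ?_⟩
  · rw [coeff_divOne, map_sub, hh _ (by simpa using he), coeff_C, if_neg (fun h0 => he (by
      have := congrArg (fun f : Fin 2 →₀ ℕ => f 1) h0; simpa using this)), sub_zero]
  · have hdiv : ∀ e : Fin 2 →₀ ℕ, coeff e (h - C (constantCoeff h)) ≠ 0 → 1 ≤ e 0 := by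
      intro e he
      by_contra hlt
      have he0 : e 0 = 0 := by omega
      apply he
      by_cases he1 : e 1 = 0
      · have hz : e = 0 := by
          ext i; fin_cases i
          · simpa using he0
          · simpa using he1
        rw [hz, map_sub, coeff_zero_eq_constantCoeff_apply, coeff_C, if_pos rfl, sub_self]
      · rw [map_sub, hh e he1, coeff_C, if_neg (fun h0 => he1 (by rw [h0]; rfl)), sub_zero]
    have h1 := X_pow_mul_divOne 1 (h - C (constantCoeff h)) hdiv
    rw [pow_one] at h1
    rw [h1, add_sub_cancel]

open scoped Classical in
/-- **THE CONFLICT STEP.**  Let `b` represent the positive label `A` with boundary `N`, and let `A` carry a permissible graph branch with datum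
`λ + u₁h₁` (`h₁` `u₂`-free) and re-centring `ψ` (`ψ(0) = 0`).  The point blow-up is a legal count move all of whose successors are unit × monomial,
or represent `blowOneT d (shearT (C c) A)` with boundary `{u₁} ∪ {u₂ : u₂ ∈ N, c = 0}` — and at `c = λ` that label carries a permissible graph branch
with datum `h₁` —, or represent `blowTwoT d A` with boundary `{u₂} ∪ {u₁ : u₁ ∈ N}`. -/
theorem conflict_pointMove (hd : 0 < d) {A : Fin d → MvPowerSeries (Fin 2) k} (hpos : IsPosT d A) {b : MvPowerSeries (Fin 3) k}
    {N : Finset (Fin 2)} (hrep : NCPoly.Represents b d A N) (la : k) (h₁ ψ : MvPowerSeries (Fin 2) k)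
    (hh₁ : ∀ e : Fin 2 →₀ ℕ, e 1 ≠ 0 → coeff e h₁ = 0) (hψ : constantCoeff ψ = 0)
    (hperm : IsPermissibleTwoT d (shift d (shearT (C la + X 0 * h₁) A) ψ)) :
    ∃ Φ : Fin 3 → MvPowerSeries (Fin 3) k, IsCountMove (m := 2) Φ (fun _ => 1) ∧
      MoveClause (m := 2) b Φ (fun _ => 1) (fun b' => NCPoly.IsStdNC b' ∨
        (∃ c : k, NCPoly.Represents b' d (blowOneT d (shearT (C c) A)) (insert 0 (N.filter fun l => l = 1 ∧ c = 0)) ∧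
          (c = la → ∃ ψ' : MvPowerSeries (Fin 2) k, constantCoeff ψ' = 0 ∧
            IsPermissibleTwoT d (shift d (shearT h₁ (blowOneT d (shearT (C c) A))) ψ'))) ∨
        NCPoly.Represents b' d (blowTwoT d A) (insert 1 (N.filter fun l => l = 0))) := by
  obtain ⟨Φ, hmv, hcl⟩ := NCPoly.pointMove_of_represents hpos hrep
  refine ⟨Φ, hmv, hcl.mono fun b' hb' => hb'.imp_right ?_⟩
  rintro ⟨c, -, (⟨hc0, hrep'⟩ | ⟨-, -, hrep'⟩)⟩
  · refine Or.inl ⟨c 1 / c 0, ?_, ?_⟩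
    · have hN : insert 0 (N.filter fun l => l = 1 ∧ c 1 = 0) = insert (0 : Fin 2) (N.filter fun l => l = 1 ∧ c 1 / c 0 = 0) := by
        congr 1
        exact Finset.filter_congr fun l _ => by rw [div_eq_zero_iff, or_iff_left hc0]
      rw [← hN]
      exact hrep'
    · rintro hc
      rw [hc]
      have hposY : IsPosT d (shift d (shearT (C la) A) 0) := by
        rw [shift_zero']; exact isPosT_shearT _ hpos
      have h := graph_blowOneT_translate hd A la h₁ ψ 0 hh₁ hψ (map_zero _) hposY hperm
      rwa [shift_zero'] at h
  · exact Or.inr hrep'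

open scoped Classical in
/-- The conflict step from a graph datum `(h, ψ)` as in `HasGraphCurveT`: at the translated point `c = h(0)` the successor label has a graph curve. -/
theorem conflict_pointMove' (hd : 0 < d) {A : Fin d → MvPowerSeries (Fin 2) k} (hpos : IsPosT d A) {b : MvPowerSeries (Fin 3) k}
    {N : Finset (Fin 2)} (hrep : NCPoly.Represents b d A N) (h ψ : MvPowerSeries (Fin 2) k)
    (hh : ∀ e : Fin 2 →₀ ℕ, e 1 ≠ 0 → coeff e h = 0) (hψ : constantCoeff ψ = 0) (hperm : IsPermissibleTwoT d (shift d (shearT h A) ψ)) :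
    ∃ Φ : Fin 3 → MvPowerSeries (Fin 3) k, IsCountMove (m := 2) Φ (fun _ => 1) ∧
      MoveClause (m := 2) b Φ (fun _ => 1) (fun b' => NCPoly.IsStdNC b' ∨
        (∃ c : k, NCPoly.Represents b' d (blowOneT d (shearT (C c) A)) (insert 0 (N.filter fun l => l = 1 ∧ c = 0)) ∧
          (c = constantCoeff h → HasGraphCurveT d (blowOneT d (shearT (C c) A)))) ∨
        NCPoly.Represents b' d (blowTwoT d A) (insert 1 (N.filter fun l => l = 0))) := by
  obtain ⟨h₁, hh₁, hsplit⟩ := exists_eq_C_add_X_mul_of_noY h hh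
  rw [hsplit] at hperm
  obtain ⟨Φ, hmv, hcl⟩ := conflict_pointMove hd hpos hrep (constantCoeff h) h₁ ψ hh₁ hψ hperm
  refine ⟨Φ, hmv, hcl.mono fun b' hb' => hb'.imp_right fun hb'' => hb''.imp_left ?_⟩
  rintro ⟨c, hrep', hgraph⟩
  refine ⟨c, hrep', fun hc => ?_⟩
  obtain ⟨ψ', hψ', hperm'⟩ := hgraph hc
  exact ⟨h₁, ψ', hh₁, hψ', hperm'⟩

end TOT2Curve

end Summit.ResolutionOfSingularities.ResolutionOfSingularities.Theorems

end
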